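import Literature.MathematicalPhysics.KineticTheory.LangevinChainGibbs
import Literature.MathematicalPhysics.KineticTheory.LangevinChainExpMartingale

/-!
# Crux idea K5 (gen 3) — the temperature–friction gauge

Sketch for the crux-ideate card `temperature-friction-gauge` on
`ContactStieltjesMeasure.StieltjesRepresentation` (stmt-AtomisticToContinuum-15248).

The chain `A(δ)` = `pinnedChain ω₂ lam β γ` run at bath temperatures `(T + δ/2, T - δ/2)` has the
same noise amplitudes `√(2γT_b)` as the *equilibrium* chain `B(δ)` at temperature `(T, T)` with the
split frictions `γ_L = γ (T+δ/2)/T`, `γ_R = γ (T-δ/2)/T`; the two differ by the first-order drift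
`(γδ/2T)(p₀ ∂_{p₀} - p_{N-1} ∂_{p_{N-1}})`, so they are mutually absolutely continuous on path space
(Girsanov), with quadratic-variation cost `(γδ²/8T²) ∫₀ᵗ Σ_b p_b²/T_b ds`, which is exponentially
integrable by `pinnedChain_lintegral_exp_hamiltonian_add_dissipation_le`.

Below: the infinitesimal signature of the gauge (`GaugeDefect`, an instance of the tree lemma
`pinnedChain_integral_generator_gibbsMeasure`), the FIRST LEMMA of the line
(`KernelCesaroSubGibbs`), its consequence for invariant measures (`NearFieldGibbsBand`) and the
residual far-field statement the line does NOT supply (`FarTailFirstMoment`).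
-/

open MeasureTheory
open scoped NNReal

namespace Summit.AtomisticToContinuum.FouriersLaw.Cruxes.StieltjesRepresentation.IdeasK5g3

open Literature.MathematicalPhysics.KineticTheory.HeatConduction

/-- (L0) Infinitesimal gauge identity: against the Gibbs measure at the mean temperature `T`, the
two-temperature generator acts as the antisymmetric friction defect
`(γδ/2T)(p₀∂_{p₀} - p_{N-1}∂_{p_{N-1}})` (weighted form, as in the tree lemma
`pinnedChain_integral_generator_gibbsMeasure` with `T_L = T + δ/2`, `T_R = T - δ/2`). -/
def GaugeDefect : Prop :=
  ∀ ω₂ lam β γ T δ : ℝ, 0 < T → ∀ N : ℕ, ∀ f : PhaseSpace N → ℝ, ContDiff ℝ 2 f → HasCompactSupport f →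
    ∫ x, (pinnedChain ω₂ lam β γ).generator N (T + δ / 2) (T - δ / 2) f x
        ∂((pinnedChain ω₂ lam β γ).gibbsMeasure N T) =
      (∫ x, (pinnedChain ω₂ lam β γ).gibbsDensity N T x)⁻¹ *
        (γ * ∑ i : Fin N, ((if i.val = 0 then δ / (2 * T) else 0) +
          (if i.val = N - 1 then -(δ / (2 * T)) else 0)) *
            ∫ x, x.2 i * partialP i f x * (pinnedChain ω₂ lam β γ).gibbsDensity N T x)

/-- (L0) is the tree lemma specialised: a one-line check of the gauge. -/
theorem gaugeDefect : GaugeDefect := by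
  intro ω₂ lam β γ T δ hT N f hf hfc
  rw [pinnedChain_integral_generator_gibbsMeasure ω₂ lam β γ N T (T + δ / 2) (T - δ / 2) hf hfc]
  have h1 : (T + δ / 2) / T - 1 = δ / (2 * T) := by field_simp; ring
  have h2 : (T - δ / 2) / T - 1 = -(δ / (2 * T)) := by field_simp; ring
  simp_rw [h1, h2]
  rfl

/-- (L1) **First lemma — kernel Cesàro sub-Gibbs domination.** For the two-temperature chain at
`(T + δ/2, T - δ/2)`, Cesàro averages of the transition kernel started anywhere in the energy
sublevel `{H ≤ R}` are dominated, for `t ≥ t₀(R, ε, g)` and `|δ| ≤ δ₁(R, ε, g)`, by twice the square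
root of the Gibbs(`T`) expectation: the Girsanov–Cauchy–Schwarz transfer from the gauge-equivalent
equilibrium chain, whose Cesàro averages converge to Gibbs(`T`) uniformly on compacts. -/
def KernelCesaroSubGibbs : Prop :=
  ∀ ω₂ lam β γ T : ℝ, 0 < ω₂ → 0 ≤ lam → 0 ≤ β → 0 < γ → 0 < T → ∀ N : ℕ, 2 ≤ N →
    ∀ R ε : ℝ, 0 < ε → ∀ g : PhaseSpace N → ℝ, Continuous g → (∀ x, 0 ≤ g x ∧ g x ≤ 1) →
      ∃ t₀ : ℝ, 0 < t₀ ∧ ∃ δ₁ : ℝ, 0 < δ₁ ∧ ∀ t : ℝ, t₀ ≤ t → ∀ δ : ℝ, |δ| ≤ δ₁ →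
        ∀ x : PhaseSpace N, (pinnedChain ω₂ lam β γ).hamiltonian N x ≤ R →
          1 / t * ∫ s in (0 : ℝ)..t,
              (∫ y, g y ∂((pinnedChain ω₂ lam β γ).transitionKernel N (T + δ / 2) (T - δ / 2)
                s.toNNReal x)) ≤
            2 * Real.sqrt (∫ y, g y ∂((pinnedChain ω₂ lam β γ).gibbsMeasure N T)) + ε

/-- (L2) **Near-field Gibbs band domination** (consequence of (L1) by invariance + Fubini): every
probability measure invariant under the two-temperature transition kernels at `(T + δ/2, T - δ/2)`,
`|δ| ≤ δ₁(R, R', ε)`, gives each bounded energy band at most `2√(Gibbs tail) + ε` mass — whatever it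
does at infinite energy.  Hence tightness of the near-equilibrium steady states is equivalent to
"no escape of mass to infinite energy", and every vague limit point as `δ → 0` is sub-Gibbs. -/
def NearFieldGibbsBand : Prop :=
  ∀ ω₂ lam β γ T : ℝ, 0 < ω₂ → 0 ≤ lam → 0 ≤ β → 0 < γ → 0 < T → ∀ N : ℕ, 2 ≤ N →
    ∀ R R' ε : ℝ, 0 < ε → ∃ δ₁ : ℝ, 0 < δ₁ ∧ ∀ δ : ℝ, |δ| ≤ δ₁ →
      ∀ μ : Measure (PhaseSpace N), IsProbabilityMeasure μ →
        (∀ t : ℝ≥0, μ.bind ⇑((pinnedChain ω₂ lam β γ).transitionKernel N (T + δ / 2) (T - δ / 2) t) = μ) →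
          μ.real {x | R < (pinnedChain ω₂ lam β γ).hamiltonian N x ∧
              (pinnedChain ω₂ lam β γ).hamiltonian N x ≤ R'} ≤
            2 * Real.sqrt (((pinnedChain ω₂ lam β γ).gibbsMeasure N T).real
              {x | R - 1 < (pinnedChain ω₂ lam β γ).hamiltonian N x}) + ε

/-- (L3) **The residual the gauge does NOT supply — far-tail first moment.** The energy-weighted mass
of the near-equilibrium weak steady states beyond a fixed energy level is `o(δ)`.  By (L2) this is
purely a statement about escape to infinite energy (far-field non-trapping); it is what the
identification step of the crux consumes on top of (L2). -/
def FarTailFirstMoment : Prop :=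
  ∀ ω₂ lam β γ T : ℝ, 0 < ω₂ → 0 ≤ lam → 0 ≤ β → 0 < γ → 0 < T → ∀ N : ℕ, 2 ≤ N →
    ∀ ε : ℝ, 0 < ε → ∃ R : ℝ, ∃ δ₁ : ℝ, 0 < δ₁ ∧ ∀ δ : ℝ, 0 < |δ| → |δ| ≤ δ₁ →
      ∀ μ : Measure (PhaseSpace N),
        (pinnedChain ω₂ lam β γ).IsSteadyState N (T + δ / 2) (T - δ / 2) μ →
          ∫ x in {x | R < (pinnedChain ω₂ lam β γ).hamiltonian N x},
              (pinnedChain ω₂ lam β γ).hamiltonian N x ∂μ ≤ ε * |δ|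

end Summit.AtomisticToContinuum.FouriersLaw.Cruxes.StieltjesRepresentation.IdeasK5g3
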